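import Literature.NumberTheory.EllipticCurves.Tian2014.CMPointSystemBridgeArithmetic
import HarnessLib

/-!
# The point identification «`z = u·ϕ(z_N) + t₀ + (1+√2, 2+√2)`» (PROOF-A Lemma 8.1, step (8.1.4)) as a
# KERNEL THEOREM of the complex-analytic objects of Tian 2014 §2 and TYZ 2017 §3 — the (B4) flag shrinks from
# the assembled identification to Tian's and TYZ's own sentences (`T(A) = t_{[0],−1}`, `T(B)` of exact order `4`,
# `f` unique up to `−1`, `z_N = f₀([i]P_N)`), with the two `2 × 2` matrix identities checked in the kernel

Cell `bsd-monsky` (prover-A seat, g7; lit's reading of ROUND 245 in `lit/BRIDGE81-INPUTS-CITE-SHEET.md`: «the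
maximal version — display the TYZ-side data (A, i₀, [i], f₀, P_N, z_N, ϕ) with the printed sentences and prove
(8.1.1)–(8.1.6)»). HONEST FRAMING: nothing asserted; every `def … : Prop` below is a displayed sentence of Tian
2014 (arXiv:1210.8231, `pNNNN LMM` = page:line of the materialised text; journal Camb. J. Math. 2 (2014), J-pages)
or of Tian–Yuan–Zhang 2017 (Asian J. Math. 21, J-pages / arXiv chunks) with its locator, on abstract DATA; the
kernel theorem is pure algebra in the group `E′(ℂ)` plus the arithmetic of two Möbius transformations. The
typer's display (B2) `CMPointData.tianPointIdentification` (p406554) stays the consumer interface: it is PROVED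
here from the displays below (`tianPointIdentification_of_maximalDisplays`), so `GrossZagierMaximal ⟹
GrossZagierBridged` and the restated fact `tian2014_system_sMinus_maximal` implies `tian2014_system_sMinus_bridged`,
hence every enclosure form of C-P2-1.

## The objects (Tian 2014 §2; TYZ 2017 §3.1–3.2), as data `BridgeData D`

* `E′ = (X₀(32), [∞])`, «an elliptic curve over `ℚ` with the cusp `[∞]` as its zero element», Weierstrass equation
  `y² = x³ + 4x`, CM by `ℤ[i]` (Tian Prop. 2.1, p0006 L23–L27, J124) = TYZ's `A` («`X₀(32)` … `A : 2y² = x³ + x`»,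
  TYZ J737): its complex points are an abstract additive group `A` with the complex uniformisation `cm : z ↦ [z]`
  («for each `z ∈ ℋ ∪ ℙ¹(ℚ)`, let `[z]` denote the point on `X₀(32)(ℂ)` represented by `z`», Tian p0006 L19)
  and the complex multiplication `[i]` (`iota`, an automorphism of `E′_ℂ`, hence additive).
* Tian's modular parametrisation `f : X₀(32) → E`, «of degree `2` mapping the cusp `[∞]` … to the zero element
  `0 ∈ E`» (p0005 L77–L79; p0003 L1–L3), and TYZ's `ϕ : A → E`, «the isogeny of degree 2» (J751 L45), both as
  additive maps `A → E(ℂ)` (an isogeny is a homomorphism, Silverman AEC III.4.8).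
* A complex embedding `emb : H(i) → ℂ` (TYZ's geometrically connected components of `X_U` are indexed by
  `Hom(ℚ(i), ℂ)`, J737; Tian's `z ∈ E(K^{ab}) ⊂ E(ℂ)`).
* The points: `P = [(2 + i√(2n))/8]` (Tian Def. 2.7 VERBATIM, `ptP`), `[h]` with `h = i/(4√(2n))` the fixed point in
  `ℋ` of `√−N ↦ (0 1/4; −4N 0)`, `N = 2n` (TYZ p0010 L84–L89: «`P_n = [h, 1] ∈ X_U(ℂ)` … `h ∈ ℋ^{K_n^×}` the unique
  fixed point»; the fixed-point equation `h = −1/(16Nh)` is CHECKED in the kernel, `moebius_fixedPoint_hPoint`), the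
  cusp `[0]` (`ptC0 = cm 0`; «`[0] = (2, 4)`», Prop. 2.1) and TYZ's CM point `z_N = f_N(P_N)` (`ptZN`, p0010 L90–L93).

## The displays (one printed sentence each)

* `tianDefZ` — Def. 2.7: «define a CM point `z := f(P) + (1 + √2, 2 + √2) ∈ E(K^{ab})`» (p0011 L31–L33), read in
  `E(ℂ)` through `emb`, with `√2 ∈ H` (Tian §4.2 p0022 L52: «Thus `√2 ∈ H₀`»).
* `fEqPhi` — «Such `f` is unique up to multiplication by `−1`» (p0003 L3) applied to TYZ's degree-`2` parametrisation
  `ϕ : A = X₀(32) → E`, `[∞] ↦ 0` (J751 L45): `f = ±ϕ`. (PROOF-A (8.1.1), with Silverman III.4.8/4.11/10.1 as the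
  textbook route to the same sentence.)
* `tianTA` — Prop. 2.1 proof: «`T(A) = t_{α,−1}` for some point `α` … `α = T(AB²)([∞]) = [0]`» (p0006 L67–L75), with
  `T(A)[z] = [A·z]`, `A = (0 1; −32 0)` (p0006 L43–L59; `T` the homomorphism induced by the action of `N` on `ℋ`,
  p0006 L28–L36) and `t_{α,ε}(x) = ε(x) + α` (p0006 L37–L42): `[A·z] = −[z] + [0]` on `ℋ`.
* `tianTB` — Prop. 2.1 proof: «Also `T(B)` maps `[∞]` to itself. Thus `T(B) ∈ Aut(E′_ℂ)` is an automorphism of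
  `E′_ℂ` of exact order `4`» (p0006 L62–L65), `B = (1 1/4; 0 1)`; the automorphisms of exact order `4` of a curve
  with `Aut = μ₄` are `[±i]` (Silverman III.10.1): `[B·z] = [±i]·[z]` on `ℋ`. (PROOF-A (8.1.2), second sentence.)
* `tyzZN` — TYZ: «`f_n := f₀∘[i]` if `n ≡ 6 (mod 8)`» (p0010 L39–L44), «`z_n = f_n(P_n)`» (p0010 L90–L93), `f₀`
  the identity on each component of `X_U ≅ X₀(32)_{ℚ(i)}` (p0010 L31–L33) and `[i]` acting on the component of
  `P_n` as `[±i]` — the sentence TYZ themselves use on J747 («`f₀([i]P_n^ε) = f₀(([−i]P_n)^ε)`», p0014 L105–L111):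
  `z_N = [±i]·[h]`. (PROOF-A (8.1.3).)
* `wEqPhiZN` — the typer's point `w` IS `ϕ(z_N)` («`R_χ = ϕ(P_χ)`», J751 L46–L47; (B1) of p406554 is TYZ p. 749 for
  this `w`): `emb(w) = ϕ(z_N)`.
* `phiIotaCuspTwoTorsion` — `2·ϕ([i][0]) = 0`: `[0] = (2, 4)` has `2·[0] = (0, 0)` (duplication on `y² = x³ + 4x`;
  Tian: «`[0]` must be a rational point of exact order `4`», p0006 L74–L75, TYZ basic fact (3) `τ(1/2) = [0]`,
  `τ(1) = [1/16]`, p0012 L16–L18), `[i](0, 0) = (0, 0)` (`[i](x, y) = (−x, iy)`), and `ker ϕ = {0, (0, 0)}` (TYZ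
  Lemma 3.16 proof: «these two morphisms have the same kernel `{0, τ(1)}`», p0017 L98–L103 = J754).

## The kernel content

`ptP_eq_of_tianTA_tianTB` = PROOF-A (8.1.2): `A·h = i√N/8` and `B·(i√N/8) = (2 + i√N)/8` (`moebius_matA_hPoint`,
`moebius_matB`; `h² = −1/(16N)`), so `P = [B·A·h] = [±i]·(−[h] + [0])`; `tianPointIdentification_of_maximalDisplays`
= (8.1.4) with the torsion term `t₀ = ±ϕ([i][0]) ∈ E[2] = {0, (0,0), (±1, 0)}` (the tree's
`eq_zero_or_eq_twoTorsion_of_two_nsmul_eq_zero`), fixed by every `σ_s` and transported back to `E(H(i))` by the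
injectivity of `Point.map emb`. Nothing booked; no mark moved.
[cite: Tian2014, Def. 2.7 (p0011 L25–L36), Prop. 2.1 and its proof (p0006 L25–L75), p0003 L1–L3, §4.2 (p0022 L47–L53)]
[cite: TianYuanZhang2017, §3.1 (p0010 L31–L44, L84–L93), J747 (p0014 L105–L111), J751 (p0016 L45–L50), Lemma 3.16 (p0017 L98–L103)]
[cite: SilvermanAEC2009, Prop. III.4.8, Thm. III.10.1]
-/

noncomputable section

open scoped Classical

open WeierstrassCurve NumberField Literature.NumberTheory.EllipticCurves
  Literature.NumberTheory.EllipticCurves.TianYuanZhang2017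

namespace Literature.NumberTheory.EllipticCurves.Tian2014

/-! ## §3 The data -/

namespace CMPointData

variable {n : ℕ}

/-- `σ_s` fixes each of the four `2`-torsion points (they are rational). [cite: Tian2014, Thm. 2.8 (p0011 L37–L44)] [folklore] -/
theorem act_twoTorsion (D : CMPointData n) (σ : D.H ≃ₐ[ℚ] D.H) {T : EPoint D.H}
    (hT : T = 0 ∨ T = ptZero ∨ T = ptOne ∨ T = ptNegOne) : D.act σ T = T := by
  rcases hT with rfl | rfl | rfl | rfl
  · exact map_zero _
  · exact map_ptZero σ.toAlgHom
  · exact map_ptOne σ.toAlgHom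
  · exact map_ptNegOne σ.toAlgHom

/-- **The complex-analytic objects of Tian 2014 §2 / TYZ 2017 §3.1 behind PROOF-A Lemma 8.1** (objects only;
nothing asserted): a complex embedding of `H(i)`; the group `E′(ℂ) = X₀(32)(ℂ)` (origin `[∞]`; TYZ's `A`) with the
complex uniformisation `z ↦ [z]` and the complex multiplication `[i]`; Tian's parametrisation `f` and TYZ's isogeny
`ϕ` as homomorphisms to `E(ℂ)`; TYZ's CM point `z_N`.
[cite: Tian2014, Prop. 2.1 (p0006 L23–L27), §2 (p0005 L77–L79, p0006 L4–L24)] [cite: TianYuanZhang2017, §3.1 (p0010 L31–L44, L84–L93), J751 (p0016 L45)] -/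
structure BridgeData (D : CMPointData n) : Type 1 where
  /-- a complex embedding `H(i) → ℂ` -/
  emb : D.H →ₐ[ℚ] ℂ
  /-- the complex points of `E′ = (X₀(32), [∞])` (TYZ's `A`), as an additive group -/
  A : Type
  [instAddCommGroup : AddCommGroup A]
  /-- the complex uniformisation `z ↦ [z]` (junk value off `ℋ ∪ ℙ¹(ℚ)`) -/
  cm : ℂ → A
  /-- Tian's modular parametrisation `f : X₀(32) → E`, `[∞] ↦ 0`, on complex points -/
  f : A →+ EPoint ℂ
  /-- TYZ's isogeny `ϕ : A → E` of degree `2`, on complex points -/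
  phi : A →+ EPoint ℂ
  /-- the complex multiplication `[i]` of `E′` -/
  iota : A →+ A
  /-- TYZ's CM point `z_N = f_N(P_N) ∈ A` -/
  ptZN : A

attribute [instance] BridgeData.instAddCommGroup

namespace BridgeData

variable {D : CMPointData n} (B : D.BridgeData)

/-- Tian's CM point `P ∈ X₀(32)`, «the image of `(2 + i√(2n))/8` under the complex uniformization».
[cite: Tian2014, Def. 2.7 (p0011 L25–L31)] -/
def ptP : B.A := B.cm ((2 + Complex.I * (Real.sqrt (2 * n : ℕ) : ℂ)) / 8)

/-- `A₀ = [h]`, the image in `X₀(32)(ℂ)` of TYZ's CM point `P_N = [h, 1]`, `h = i/(4√N)`, `N = 2n`.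
[cite: TianYuanZhang2017, §3.1 (p0010 L84–L89)] -/
def ptA0 : B.A := B.cm (hPoint (2 * n))

/-- The cusp `[0]` (`= (2, 4)`, a rational point of exact order `4`). [cite: Tian2014, Prop. 2.1 (p0006 L25–L27, L74–L75)] -/
def ptC0 : B.A := B.cm 0

/-- The base change `E(H(i)) → E(ℂ)` along `emb`. [cite: TianYuanZhang2017, §3.1 (p0010 L31–L33)] [folklore] -/
def toC : EPoint D.H →+ EPoint ℂ := WeierstrassCurve.Affine.Point.map B.emb

/-! ## §4 The displays -/

/-- **Def. 2.7**: «define a CM point `z := f(P) + (1 + √2, 2 + √2) ∈ E(K^{ab})`», in `E(ℂ)`; `√2 ∈ H` («Thus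
`√2 ∈ H₀`», §4.2). [cite: Tian2014, Def. 2.7 (p0011 L31–L33), §4.2 (p0022 L52)] -/
def tianDefZ : Prop :=
  ∃ (r : D.H) (hr : r ^ 2 = 2), B.toC (D.z 1) = B.f B.ptP + B.toC (D.ptQ4 r hr)

/-- **«Such `f` is unique up to multiplication by `−1`»** (p0003 L3), applied to TYZ's degree-`2` parametrisation
`ϕ : A = X₀(32) → E`, `[∞] ↦ 0` (J751): `f = ±ϕ`. (PROOF-A (8.1.1).)
[cite: Tian2014, p0003 L1–L3] [cite: TianYuanZhang2017, J751 (p0016 L45)] [cite: SilvermanAEC2009, Prop. III.4.11, Thm. III.10.1] -/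
def fEqPhi : Prop :=
  ∃ ε : ℤ, (ε = 1 ∨ ε = -1) ∧ ∀ a, B.f a = ε • B.phi a

/-- **Prop. 2.1 proof: `T(A) = t_{[0],−1}`** — «`T(A) = t_{α,−1}` for some point `α` … `α = T(AB²)([∞]) = [0]`»,
`t_{α,ε}(x) = ε(x) + α`, `T(A)[z] = [A·z]`: `[A·z] = −[z] + [0]` for `z ∈ ℋ`.
[cite: Tian2014, Prop. 2.1 proof (p0006 L28–L42, L67–L75)] -/
def tianTA : Prop :=
  ∀ z : ℂ, 0 < z.im → B.cm (moebius matA z) = -B.cm z + B.ptC0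

/-- **Prop. 2.1 proof: `T(B)` is an automorphism of `E′_ℂ` of exact order `4`** — «Also `T(B)` maps `[∞]` to itself.
Thus `T(B) ∈ Aut(E′_ℂ) is an automorphism of `E′_ℂ` of exact order 4» — i.e. `T(B) = [±i]` (`Aut(E′) = μ₄`,
Silverman III.10.1): `[B·z] = [±i]·[z]` for `z ∈ ℋ`. (PROOF-A (8.1.2), second sentence.)
[cite: Tian2014, Prop. 2.1 proof (p0006 L60–L65)] [cite: SilvermanAEC2009, Thm. III.10.1] -/
def tianTB : Prop :=
  ∃ ε : ℤ, (ε = 1 ∨ ε = -1) ∧ ∀ z : ℂ, 0 < z.im → B.cm (moebius matB z) = ε • B.iota (B.cm z)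

/-- **TYZ: `z_N = f_N(P_N) = f₀([i]P_N) = [±i]·[h]`** («`f_n := f₀∘[i]` if `n ≡ 6 (mod 8)`», `f₀` the identity on
each component of `X_U ≅ X₀(32)_{ℚ(i)}`, `[i]` acting on the component of `P_n` as `[±i]` — as used by TYZ on J747).
(PROOF-A (8.1.3).) [cite: TianYuanZhang2017, §3.1 (p0010 L31–L44, L90–L93), J747 (p0014 L105–L111)] -/
def tyzZN : Prop :=
  ∃ ε : ℤ, (ε = 1 ∨ ε = -1) ∧ B.ptZN = ε • B.iota B.ptA0

/-- **`w = ϕ(z_N)`** (the point `w` of the typer's (B1)/(B2), «`R_χ = ϕ(P_χ)`»): `emb(w) = ϕ(z_N)`.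
[cite: TianYuanZhang2017, J751 (p0016 L45–L50)] -/
def wEqPhiZN (w : EPoint D.H) : Prop :=
  B.toC w = B.phi B.ptZN

/-- **`2·ϕ([i][0]) = 0`**: `2·[0] = (0, 0)` (`[0] = (2, 4)` of exact order `4` on `y² = x³ + 4x`; TYZ `τ(1/2) = [0]`,
`τ(1) = [1/16]`), `[i](0, 0) = (0, 0)`, and `ker ϕ = {0, (0, 0)}` («the same kernel `{0, τ(1)}`», TYZ Lemma 3.16).
[cite: Tian2014, Prop. 2.1 (p0006 L25–L27, L74–L75)] [cite: TianYuanZhang2017, basic fact (3) (p0012 L16–L18), Lemma 3.16 (p0017 L98–L103)] -/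
def phiIotaCuspTwoTorsion : Prop :=
  (2 : ℕ) • B.phi (B.iota B.ptC0) = 0

/-- The seven displays together, for the point `w` (= `ϕ(z_N)`) of the bridge.
[cite: Tian2014, Def. 2.7, Prop. 2.1, p0003 L1–L3] [cite: TianYuanZhang2017, §3.1, J747, J751, Lemma 3.16] -/
def MaximalDisplays (w : EPoint D.H) : Prop :=
  B.tianDefZ ∧ B.fEqPhi ∧ B.tianTA ∧ B.tianTB ∧ B.tyzZN ∧ B.wEqPhiZN w ∧ B.phiIotaCuspTwoTorsion

/-! ## §5 The kernel content: (8.1.2) and (8.1.4) -/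

/-- **PROOF-A (8.1.2) in the kernel**: `P = [B·A·h] = [±i]·(−[h] + [0])` — from `T(A) = t_{[0],−1}`, `T(B) = [±i]` and
the two matrix identities `A·h = i√N/8`, `B·(i√N/8) = (2 + i√N)/8`. [cite: Tian2014, Def. 2.7, Prop. 2.1 proof (p0006 L43–L75)] -/
theorem ptP_eq_of_tianTA_tianTB (hn : n ≠ 0) (hA : B.tianTA) (hB : B.tianTB) :
    ∃ ε : ℤ, (ε = 1 ∨ ε = -1) ∧ B.ptP = ε • B.iota (-B.ptA0 + B.ptC0) := by
  obtain ⟨ε, hε, hB⟩ := hB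
  have hN : 2 * n ≠ 0 := Nat.mul_ne_zero two_ne_zero hn
  refine ⟨ε, hε, ?_⟩
  have h1 : B.ptP = B.cm (moebius matB (moebius matA (hPoint (2 * n)))) := by
    rw [ptP, moebius_matA_hPoint hN, moebius_matB_eq]
  rw [h1, hB _ (by rw [moebius_matA_hPoint hN]; exact im_I_mul_sqrt_div_pos hN),
    hA _ (hPoint_im_pos hN), ptA0]

/-- **PROOF-A (8.1.4) in the kernel — the typer's display (B2) is a THEOREM of the maximal displays**: from
Def. 2.7, `f = ±ϕ`, (8.1.2) (`ptP_eq_of_tianTA_tianTB`), `z_N = [±i]·[h]`, `w = ϕ(z_N)` and `2·ϕ([i][0]) = 0`: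
`z = u·w + t₀ + (1 + √2, 2 + √2)` with `u = ±1` and `t₀ = ±ϕ([i][0]) ∈ E[2] ⊂ E(ℚ)`, fixed by every `σ_s`; the
identity holds in `E(ℂ)` and descends to `E(H(i))` by the injectivity of the base change.
[cite: Tian2014, Def. 2.7 (p0011 L25–L36), Prop. 2.1 proof (p0006 L43–L75), p0003 L1–L3]
[cite: TianYuanZhang2017, §3.1 (p0010 L31–L44, L84–L93), J747, J751, Lemma 3.16] -/
theorem tianPointIdentification_of_maximalDisplays (hn : n ≠ 0) {w : EPoint D.H}
    (h : B.MaximalDisplays w) : D.tianPointIdentification w := by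
  obtain ⟨⟨r, hr, hz⟩, ⟨ε₁, hε₁, hf⟩, hA, hB, ⟨ε₃, hε₃, hZN⟩, hw, h2⟩ := h
  obtain ⟨ε₂, hε₂, hP⟩ := B.ptP_eq_of_tianTA_tianTB hn hA hB
  -- the torsion term `t₀ = ε₁ε₂·ϕ([i][0])`, a `2`-torsion point of `E(ℂ)`, hence one of the four rational ones
  obtain ⟨T, hT, hTC⟩ : ∃ T : EPoint D.H, (T = 0 ∨ T = ptZero ∨ T = ptOne ∨ T = ptNegOne) ∧
      B.toC T = B.phi (B.iota B.ptC0) := by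
    rcases eq_twoTorsion_of_two_nsmul_eq_zero h2 with h0 | h0 | h0 | h0
    · exact ⟨0, Or.inl rfl, by rw [map_zero, h0]⟩
    · exact ⟨ptZero, Or.inr (Or.inl rfl), by rw [h0, toC, map_ptZero]⟩
    · exact ⟨ptOne, Or.inr (Or.inr (Or.inl rfl)), by rw [h0, toC, map_ptOne]⟩
    · exact ⟨ptNegOne, Or.inr (Or.inr (Or.inr rfl)), by rw [h0, toC, map_ptNegOne]⟩
  have hT2 : (2 : ℕ) • T = 0 := by
    rcases hT with rfl | rfl | rfl | rfl
    · exact smul_zero _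
    · exact two_nsmul_ptZero
    · exact two_nsmul_ptOne
    · exact two_nsmul_ptNegOne
  refine ⟨-(ε₁ * ε₂ * ε₃), (ε₁ * ε₂) • T, r, hr, ?_, ?_, ?_, ?_⟩
  · rcases hε₁ with rfl | rfl <;> rcases hε₂ with rfl | rfl <;> rcases hε₃ with rfl | rfl <;> norm_num
  · exact (isOfFinAddOrder_iff_nsmul_eq_zero.mpr ⟨2, by norm_num, hT2⟩).zsmul
  · intro s
    rw [map_zsmul, D.act_twoTorsion (D.art s) hT]
  · -- the identity in `E(ℂ)`, then descend along the injective base change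
    have hε₃₃ : ε₃ * ε₃ = 1 := by rcases hε₃ with rfl | rfl <;> norm_num
    have hw' : B.toC w = B.phi B.ptZN := hw
    have hphiA0 : B.phi (B.iota B.ptA0) = ε₃ • B.toC w := by
      rw [hw', hZN, map_zsmul, smul_smul, hε₃₃, one_smul]
    have hC : B.toC (D.z 1) = B.toC ((-(ε₁ * ε₂ * ε₃)) • w + (ε₁ * ε₂) • T + D.ptQ4 r hr) := by
      rw [hz, hf, hP]
      simp only [map_add, map_neg, map_zsmul]
      rw [hphiA0, ← hTC]
      simp only [smul_add, smul_neg, smul_smul, neg_smul]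
      rw [mul_assoc ε₁ ε₂ ε₃]
    exact WeierstrassCurve.Affine.Point.map_injective B.emb hC

end BridgeData

/-! ## §6 The Gross–Zagier relation with the maximal displays, and the restated system fact -/

/-- **The Gross–Zagier index relation with the bridge displayed in Tian's and TYZ's own sentences**: a point `R`
(= `R_{χ₀}`), integers `L`, `u` (`𝓛(2n)`, `𝓛(1)` odd), the `2`-rank `h₂`, a point `w` (= `ϕ(z_N)`), the complex
data `B`, with TYZ Thm. 3.3 at `χ₀` (`tyzThm33Chi0`, printed), (B1) `tyzTwoRSum` (TYZ p. 749, printed) and the seven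
maximal displays (`MaximalDisplays`) in place of the assembled point identification (B2).
[cite: TianYuanZhang2017, Thm. 3.3 (p. 739), p. 749, J751, Thm. 1.1, Thm. 1.4] [cite: Tian2014, Def. 2.7, Prop. 2.1] -/
def GrossZagierMaximal (D : CMPointData n) (hn : n ≠ 0) : Prop :=
  ∃ (R : EPoint D.H) (L u : ℤ) (h₂ : ℕ) (w : EPoint D.H) (B : D.BridgeData), IsScriptL (2 * n) L ∧
    IsScriptL 1 u ∧ Odd u ∧ D.tyzThm33Chi0 hn R L u h₂ ∧ D.tyzTwoRSum R w ∧ B.MaximalDisplays w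

/-- `GrossZagierMaximal ⟹ GrossZagierBridged` ((8.1.4) is now a theorem of the maximal displays).
[cite: TianYuanZhang2017, Thm. 3.3 (p. 739), p. 749] [cite: Tian2014, Def. 2.7, Prop. 2.1] -/
theorem grossZagierBridged_of_grossZagierMaximal (D : CMPointData n) (hn : n ≠ 0)
    (h : D.GrossZagierMaximal hn) : D.GrossZagierBridged hn := by
  obtain ⟨R, L, u, h₂, w, B, hL, hu, huodd, h33, hB1, hM⟩ := h
  exact ⟨R, L, u, h₂, w, hL, hu, huodd, h33, hB1, B.tianPointIdentification_of_maximalDisplays hn hM⟩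

end CMPointData

/-- **THE SYSTEM FACT WITH THE BRIDGE IN TIAN'S AND TYZ'S OWN SENTENCES**: Tian's CM-point system on `𝒮⁻` with
`Printed` (Thm. 2.8 system), `GrossZagierMaximal` (TYZ Thm. 3.3 at `χ₀` + TYZ p. 749 through `ϕ` + the seven maximal
displays: Def. 2.7, «`f` unique up to `−1`», `T(A) = t_{[0],−1}`, `T(B)` of exact order `4`, `z_N = f₀([i]P_N)`,
`w = ϕ(z_N)`, `2·ϕ([i][0]) = 0` + `𝓛(2n) ∈ ℤ`, `𝓛(1)` odd) and `GenusTheoryDisplays`. Existential over ONE system per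
`(p, q)`; implies `tian2014_system_sMinus_bridged` (`tian2014_system_sMinus_bridged_of_maximal`), hence every
enclosure form of the cell. Printed-but-unproved content = `Printed` + TYZ Thm. 3.3 + TYZ p. 749 + the seven displays
of §4 (the assembled identification (8.1.4) and the two matrix identities are now kernel theorems) + TYZ Thm. 1.1 /
1.4 + the 15 genus-theory conjuncts.
[cite: Tian2014, Def. 2.7, Thm. 2.8 (p0011 L25–L44 = J132), Prop. 2.1 (p0006 L25–L75), p0003 L1–L3, (4.8) (p0023 L46–L50), Notations (J122–123)]
[cite: TianYuanZhang2017, Thm. 3.3 (p. 739) and its proof (pp. 749–751), §3.1, J747, J751, Lemma 3.16, Thm. 1.1, Thm. 1.4] -/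
def tian2014_system_sMinus_maximal : Prop :=
  ∀ p q : ℕ, (hp : p.Prime) → (hq : q.Prime) → p % 8 = 5 → q % 4 = 3 → jacobiSym p q = -1 →
    ∃ D : CMPointData (p * q), D.Printed ∧
      D.GrossZagierMaximal (Nat.mul_ne_zero hp.ne_zero hq.ne_zero) ∧ D.GenusTheoryDisplays

/-- The maximal fact implies the bridged fact ((8.1.4) is a kernel theorem of the maximal displays).
[cite: TianYuanZhang2017, Thm. 3.3 (p. 739), p. 749] [cite: Tian2014, Def. 2.7, Prop. 2.1] -/
theorem tian2014_system_sMinus_bridged_of_maximal (h : tian2014_system_sMinus_maximal) :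
    tian2014_system_sMinus_bridged := by
  intro p q hp hq hp5 hq4 hj
  obtain ⟨D, hP, hG, hGen⟩ := h p q hp hq hp5 hq4 hj
  exact ⟨D, hP, D.grossZagierBridged_of_grossZagierMaximal _ hG, hGen⟩

end Literature.NumberTheory.EllipticCurves.Tian2014

end
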